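import Mathlib

/-!
# Stub `stub_colFix` — line `SketchIdeator3G2` of the crux `SubgroupIdentityDesigns`
(stmt-MatrixMultiplication-14079)

For `j : Fin m`, the indicator of `{g ∈ GL_m(𝔽_p) : column j of g is the unit column e_j}` has
Fourier level `≤ 1`.  With `ψ = ZMod.stdAddChar`:
`[g e_j = e_j] = ∏_i [((g - 1) e_j)_i = 0] = p^{-m} ∑_{v ∈ 𝔽_p^m} ψ((v (g - 1))_j)`
(orthogonality of `ψ`, one coordinate at a time, then the product of sums is a sum over `v`),
and `ψ((v g)_j) = ψ(tr(e_j v g))` for the rank-`≤ 1` modes `e_j v = vecMulVec (Pi.single j 1) v`.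
The coefficient table is `c M = p^{-m} ∑_v [M = e_j v] ψ(-v_j)`, which vanishes unless
`rank M ≤ 1` (`Matrix.rank_vecMulVec_le`).
-/

-- single-conjunct summit: namespace repeats MatrixMultiplication (summit = sub-problem)
set_option linter.dupNamespace false

noncomputable section

open scoped BigOperators Classical

namespace Summit.MatrixMultiplication.MatrixMultiplication.Theorems.Witnessed

variable {p m : ℕ} [Fact p.Prime]

/-- An additive character turns finite sums into finite products. -/
private theorem addChar_map_sum {A R : Type*} [AddCommMonoid A] [CommMonoid R] (ψ : AddChar A R)
    {ι : Type*} (s : Finset ι) (a : ι → A) : ψ (∑ i ∈ s, a i) = ∏ i ∈ s, ψ (a i) := by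
  induction s using Finset.induction_on with
  | empty => simp
  | insert i s hi ih =>
    rw [Finset.sum_insert hi, Finset.prod_insert hi, AddChar.map_add_eq_mul, ih]

/-- Orthogonality of `ψ = ZMod.stdAddChar` as an indicator: `[b = 0] = p⁻¹ ∑_t ψ(t b)`. -/
private theorem ite_eq_zero_eq_sum_stdAddChar (b : ZMod p) :
    (if b = 0 then (1 : ℂ) else 0) = (p : ℂ)⁻¹ * ∑ t : ZMod p, ZMod.stdAddChar (t * b) := by
  have hp : (p : ℂ) ≠ 0 := Nat.cast_ne_zero.mpr (Fact.out : p.Prime).ne_zero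
  rw [AddChar.sum_mulShift b (ZMod.isPrimitive_stdAddChar p), ZMod.card]
  split_ifs
  · rw [inv_mul_cancel₀ hp]
  · rw [Nat.cast_zero, mul_zero]

/-- `tr(e_j v G) = (v G)_j`: the trace against the mode `vecMulVec (Pi.single j 1) v` reads off the
`j`-th coordinate of the row vector `v ᵥ* G`. -/
private theorem trace_vecMulVec_single_mul (j : Fin m) (v : Fin m → ZMod p)
    (G : Matrix (Fin m) (Fin m) (ZMod p)) :
    Matrix.trace (Matrix.vecMulVec (Pi.single j 1) v * G) = Matrix.vecMul v G j := by
  rw [Matrix.vecMulVec_mul, Matrix.trace_vecMulVec, single_one_dotProduct]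

/-- **Single-column indicator has Fourier level `≤ 1`.**  For `j : Fin m`, the indicator of
`{g ∈ GL_m(𝔽_p) : column j of g is the unit column e_j}` is `∑_M c_M ψ(tr(M g))` with a
coefficient table `c` supported on matrices of rank `≤ 1`: the modes are `M = e_j v`
(`v ∈ 𝔽_p^m`) with `c_{e_j v} = p^{-m} ψ(-v_j)`, by orthogonality of `ψ = ZMod.stdAddChar`
applied to each coordinate of `(g - 1) e_j`. -/
theorem stub_colFix (j : Fin m) :
    ∃ c : Matrix (Fin m) (Fin m) (ZMod p) → ℂ, (∀ M, 1 < M.rank → c M = 0) ∧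
      ∀ g : Matrix.GeneralLinearGroup (Fin m) (ZMod p),
        (if ∀ i : Fin m, (g : Matrix (Fin m) (Fin m) (ZMod p)) i j =
            (1 : Matrix (Fin m) (Fin m) (ZMod p)) i j then (1 : ℂ) else 0) =
          ∑ M : Matrix (Fin m) (Fin m) (ZMod p),
            c M * ZMod.stdAddChar (Matrix.trace (M * (g : Matrix (Fin m) (Fin m) (ZMod p)))) := by
  refine ⟨fun M => ((p : ℂ)⁻¹) ^ m * ∑ v : Fin m → ZMod p,
      (if M = Matrix.vecMulVec (Pi.single j 1) v then ZMod.stdAddChar (-v j) else 0),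
    fun M hM => ?_, fun g => ?_⟩
  · -- support: every mode `e_j v` has rank `≤ 1`
    refine mul_eq_zero_of_right _ (Finset.sum_eq_zero fun v _ => if_neg ?_)
    rintro rfl
    exact absurd (Matrix.rank_vecMulVec_le _ _) (not_le.mpr hM)
  · set G : Matrix (Fin m) (Fin m) (ZMod p) := (g : Matrix (Fin m) (Fin m) (ZMod p))
    -- the right-hand side, summed over the modes `e_j v`
    have hR : (∑ M : Matrix (Fin m) (Fin m) (ZMod p),
        (((p : ℂ)⁻¹) ^ m * ∑ v : Fin m → ZMod p,
          (if M = Matrix.vecMulVec (Pi.single j 1) v then ZMod.stdAddChar (-v j) else 0)) *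
          ZMod.stdAddChar (Matrix.trace (M * G))) =
        ((p : ℂ)⁻¹) ^ m * ∑ v : Fin m → ZMod p,
          ZMod.stdAddChar (-v j) * ZMod.stdAddChar (Matrix.vecMul v G j) := by
      simp_rw [mul_assoc, ← Finset.mul_sum, Finset.sum_mul]
      rw [Finset.sum_comm]
      congr 1
      refine Finset.sum_congr rfl fun v _ => ?_
      simp_rw [ite_mul, zero_mul]
      rw [Finset.sum_ite_eq', if_pos (Finset.mem_univ _), trace_vecMulVec_single_mul]
    rw [hR]
    -- the left-hand side, one coordinate of `(G - 1) e_j` at a time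
    have hL : (if ∀ i : Fin m, G i j = (1 : Matrix (Fin m) (Fin m) (ZMod p)) i j then (1 : ℂ)
        else 0) = ∏ i : Fin m, ((p : ℂ)⁻¹ * ∑ t : ZMod p, ZMod.stdAddChar (t * (G - 1) i j)) :=
      calc (if ∀ i : Fin m, G i j = (1 : Matrix (Fin m) (Fin m) (ZMod p)) i j then (1 : ℂ) else 0)
          = ∏ i : Fin m, (if G i j = (1 : Matrix (Fin m) (Fin m) (ZMod p)) i j then (1 : ℂ)
              else 0) := by
            -- `Decidable (∀ i : Fin m, _)` instances differ (`Nat.decidableForallFin`); bridge them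
            rw [Fintype.prod_boole]
            congr 1
        _ = ∏ i : Fin m, ((p : ℂ)⁻¹ * ∑ t : ZMod p, ZMod.stdAddChar (t * (G - 1) i j)) :=
            Finset.prod_congr rfl fun i _ => by
              rw [← ite_eq_zero_eq_sum_stdAddChar, Matrix.sub_apply]
              exact if_congr sub_eq_zero.symm rfl rfl
    rw [hL, Finset.prod_mul_distrib, Finset.prod_const, Finset.card_univ, Fintype.card_fin,
      Fintype.prod_sum]
    congr 1
    refine Finset.sum_congr rfl fun v _ => ?_
    rw [← addChar_map_sum, ← AddChar.map_add_eq_mul]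
    congr 1
    -- `∑_i v_i (G - 1)_{ij} = -v_j + (v G)_j`
    have hv : (∑ i, v i * (G - 1) i j) = Matrix.vecMul v (G - 1) j := rfl
    rw [hv, Matrix.vecMul_sub, Matrix.vecMul_one, Pi.sub_apply]
    ring

end Summit.MatrixMultiplication.MatrixMultiplication.Theorems.Witnessed

end
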